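import Summits.MatrixMultiplication.OmegaCensus.STPPSmallPatternT1K4SeedWitnesses
import Summits.MatrixMultiplication.OmegaCensus.STPPSmallPatternT1K4OrderLawCore
import Summits.MatrixMultiplication.OmegaCensus.STPPSmallPatternCyclicRaysT1
import Summits.MatrixMultiplication.OmegaCensus.STPPSmallPatternOnsetOrdersAllHost

/-!
# ω-census, small STPP pattern `(2,1,1)^k`: THE LAW «EVERY FINITE ABELIAN GROUP OF ORDER ≥ 18 HOSTS (2,1,1)⁴» (kernel) and the closed form of the column `T1 ≥ 4`

Cell `pub-omega`, ω construction census, seat pub-omega ENG2 (gen 33). HONEST FRAMING (verbatim): lottery ticket; floor =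
certified bounds/negative ranges.  Census STRUCTURE bookkeeping (column B5, `T1`; the `(2,1,1)` analogue of stpp-3's `(1,2,2)⁴` law
`STPPSmallPatternT2K4OrderLaw.lean`, words pre-stated by RULING L37-153 «order ≥ 18 ⟺ …, with the order-16/17 clause from p662249»);
nothing here bears on `ω`.

* `exists_isSTPP_211pow4_of_card_ge_18` — **every finite abelian group of order `≥ 18` admits an STPP family of size pattern `(2,1,1)⁴`.**
* `stpp211pow4_iff` — **the column `T1 ≥ 4` in closed form over ALL finite abelian groups: `G` hosts `(2,1,1)⁴` iff `|G| ≥ 18`, or `|G| = 16`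
  and `G` is neither cyclic nor elementary abelian** (orders `≤ 15` and `17` host nothing, order `16` exactly the three types `ℤ/2×ℤ/8`,
  `ℤ/4×ℤ/4`, `ℤ/2×ℤ/2×ℤ/4` — the tree's `stpp211pow4_order16_iff` / `not_exists_isSTPP_211pow4_of_card_le`).

Proof (the shape of `STPP222CubeFrom46.lean` / `STPPSmallPatternT2K4OrderLaw.lean`, machinery reused verbatim): exponent `≥ 18` ⇒ an element
of order `≥ 18` ⇒ ENG2 gen 32's cyclic ray `exists_isSTPP_211pow4_of_addOrderOf`; exponent `E ≤ 17` ⇒ structure theorem, every prime-power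
factor divides `E`, the factor multiset capped by `capMS (capList E)` keeps product `≥ 18` (`prod_inter_ge18`), and the kernel core
`hostCore211K4_of_capped` shows it dominates one of the 19 MINIMAL seed types (stpp-3 gen 25's `STPPSmallPatternT1K4SeedWitnesses.lean`, p666131, each with a decide
witness); `exists_emb_of_dom` embeds the seed group and the witness is transported.  Order `17`: every group of order `17` is cyclic, and
`ℤ/17 ⊉ (2,1,1)⁴` (tree `not_exists_isSTPP_211pow4_zmod17`).

References: H. Cohn, R. Kleinberg, B. Szegedy, C. Umans, FOCS 2005 (arXiv:math/0511460), Def. 5.1.  Seat pub-omega ENG2 (gen 33), 2026-08-28.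
-/

open Literature.Computability.AlgebraicComplexity Finset

namespace Summit.MatrixMultiplication.OmegaCensus

/-! ## 1. The 19 minimal host seeds -/

/-- Every listed seed type hosts `(2,1,1)⁴` (kernel witnesses of stpp-3 gen 25's `STPPSmallPatternT1K4SeedWitnesses.lean` (p666131; the 19 minimal types among its 28); `SeedType s` unfolds to the witness's
product type). [cite: CohnKleinbergSzegedyUmans2005, Def. 5.1] -/
theorem exists_211pow4_of_mem_hostSeeds211K4 : ∀ s ∈ ([[3, 3, 2], [5, 2, 2], [3, 2, 2, 2], [4, 3, 2], [5, 5], [3, 3, 3], [9, 3], [7, 2, 2], [2, 2, 2, 2, 2], [4, 2, 2, 2], [8, 2, 2], [4, 4, 2], [16, 2], [8, 4], [5, 3, 3], [7, 7], [11, 11], [13, 13], [17, 17]] : List (List ℕ)),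
    ∃ A B C : Fin 4 → Finset (SeedType s), IsSTPP A B C ∧ ∀ i, (A i).card = 2 ∧ (B i).card = 1 ∧ (C i).card = 1 := by
  intro s hs
  simp only [List.mem_cons, List.mem_nil_iff, or_false] at hs
  rcases hs with rfl | rfl | rfl | rfl | rfl | rfl | rfl | rfl | rfl | rfl | rfl | rfl | rfl | rfl | rfl | rfl | rfl | rfl | rfl
  · exact exists_isSTPP_211pow4_seed_3_3_2
  · exact exists_isSTPP_211pow4_seed_5_2_2
  · exact exists_isSTPP_211pow4_seed_3_2_2_2
  · exact exists_isSTPP_211pow4_seed_4_3_2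
  · exact exists_isSTPP_211pow4_seed_5_5
  · exact exists_isSTPP_211pow4_seed_3_3_3
  · exact exists_isSTPP_211pow4_seed_9_3
  · exact exists_isSTPP_211pow4_seed_7_2_2
  · exact exists_isSTPP_211pow4_seed_2_2_2_2_2
  · exact exists_isSTPP_211pow4_seed_4_2_2_2
  · exact exists_isSTPP_211pow4_seed_8_2_2
  · exact exists_isSTPP_211pow4_seed_4_4_2
  · exact exists_isSTPP_211pow4_seed_16_2
  · exact exists_isSTPP_211pow4_seed_8_4
  · exact exists_isSTPP_211pow4_seed_5_3_3
  · exact exists_isSTPP_211pow4_seed_7_7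
  · exact exists_isSTPP_211pow4_seed_11_11
  · exact exists_isSTPP_211pow4_seed_13_13
  · exact exists_isSTPP_211pow4_seed_17_17

/-! ## 2. The capping step at threshold 18 -/

/-- If every element `a` of `M` satisfies `18 ≤ a ^ count a C` and `1 ≤ a`, and `18 ≤ M.prod`, then `M ∩ C` still has product `≥ 18`
(`prod_inter_ge` of `STPP222CubeFrom46.lean` at threshold `18`). -/
theorem prod_inter_ge18 {M C : Multiset ℕ} (hM : 18 ≤ M.prod) (hpos : ∀ a ∈ M, 1 ≤ a)
    (hcap : ∀ a ∈ M, 18 ≤ a ^ Multiset.count a C) : 18 ≤ (M ∩ C).prod := by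
  by_cases hle : M ≤ C
  · have : M ∩ C = M := le_antisymm Multiset.inter_le_left (Multiset.le_inter le_rfl hle)
    rw [this]; exact hM
  · rw [Multiset.le_iff_count] at hle
    push Not at hle
    obtain ⟨a, ha⟩ := hle
    have haM : a ∈ M := Multiset.count_pos.1 (by omega)
    have hcnt : Multiset.count a (M ∩ C) = Multiset.count a C := by
      rw [Multiset.count_inter]; omega
    have hrep : Multiset.replicate (Multiset.count a C) a ≤ M ∩ C :=
      Multiset.le_count_iff_replicate_le.1 hcnt.ge
    obtain ⟨R, hR⟩ := Multiset.le_iff_exists_add.1 hrep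
    have hRpos : ∀ x ∈ R, 1 ≤ x := fun x hx =>
      hpos x (Multiset.mem_of_le Multiset.inter_le_left (hR ▸ Multiset.mem_add.2 (Or.inr hx)))
    have h1 : 1 ≤ R.prod := Multiset.one_le_prod_of_one_le hRpos
    rw [hR, Multiset.prod_add, Multiset.prod_replicate]
    calc 18 ≤ a ^ Multiset.count a C := hcap a haM
      _ = a ^ Multiset.count a C * 1 := (mul_one _).symm
      _ ≤ a ^ Multiset.count a C * R.prod := Nat.mul_le_mul_left _ h1

/-- Domination for an arbitrary multiset of prime powers from `ppList`, all dividing some `1 ≤ E ≤ 17`, with product `≥ 18`. -/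
theorem exists_hostSeed211K4_dom {M : Multiset ℕ} {E : ℕ} (hE1 : 1 ≤ E) (hE17 : E ≤ 17)
    (hpp : ∀ a ∈ M, a ∈ ppList) (hdvd : ∀ a ∈ M, a ∣ E) (hprod : 18 ≤ M.prod) :
    ∃ s ∈ ([[3, 3, 2], [5, 2, 2], [3, 2, 2, 2], [4, 3, 2], [5, 5], [3, 3, 3], [9, 3], [7, 2, 2], [2, 2, 2, 2, 2], [4, 2, 2, 2], [8, 2, 2], [4, 4, 2], [16, 2], [8, 4], [5, 3, 3], [7, 7], [11, 11], [13, 13], [17, 17]] : List (List ℕ)), dom s M = true := by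
  have hEI : E ∈ List.range' 1 17 := List.mem_range'_1.2 ⟨hE1, by omega⟩
  have hEI45 : E ∈ List.range' 1 45 := List.mem_range'_1.2 ⟨hE1, by omega⟩
  set C := capMS (capList E) with hC
  have hcapd := prod_inter_ge18 (C := C) hprod (fun a ha => one_le_of_mem_ppList (hpp a ha))
    (fun a ha => le_trans (by norm_num) (cap_spec E hEI45 a (hpp a ha) (hdvd a ha)))
  have hmem : M ∩ C ∈ subMS (capList E) := mem_subMS_of_le _ _ Multiset.inter_le_right
  obtain ⟨s, hs, hD⟩ := hostCore211K4_of_capped E hEI (M ∩ C) hmem hcapd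
  exact ⟨s, hs, dom_mono s Multiset.inter_le_left hD⟩

/-! ## 3. The law -/

/-- The product form: `Π i, ℤ/pᵢ^eᵢ` admits `(2,1,1)⁴` as soon as every `pᵢ^eᵢ` divides some `1 ≤ E ≤ 17` and `∏ pᵢ^eᵢ ≥ 18`.
[cite: CohnKleinbergSzegedyUmans2005, Def. 5.1] -/
theorem exists_isSTPP_211pow4_pi {ι : Type} [Fintype ι] [DecidableEq ι] (p e : ι → ℕ)
    (hp : ∀ i, (p i).Prime) {E : ℕ} (hE1 : 1 ≤ E) (hE17 : E ≤ 17) (hdvd : ∀ i, p i ^ e i ∣ E)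
    (hcard : 18 ≤ ∏ i, p i ^ e i) :
    ∃ A B C : Fin 4 → Finset (Π i, ZMod (p i ^ e i)), IsSTPP A B C ∧
      ∀ i, (A i).card = 2 ∧ (B i).card = 1 ∧ (C i).card = 1 := by
  have hq0 : ∀ i, p i ^ e i ≠ 0 := fun i => pow_ne_zero _ (hp i).ne_zero
  have hprod : 18 ≤ ((Finset.univ.filter fun i => 0 < e i).val.map fun i => p i ^ e i).prod := by
    have : ((Finset.univ.filter fun i => 0 < e i).val.map fun i => p i ^ e i).prod = ∏ i, p i ^ e i := by
      rw [← Finset.prod_eq_multiset_prod]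
      exact Finset.prod_filter_of_ne fun i _ hi => Nat.pos_of_ne_zero fun h0 => hi (by rw [h0, pow_zero])
    rw [this]; exact hcard
  have hmem : ∀ a ∈ ((Finset.univ.filter fun i => 0 < e i).val.map fun i => p i ^ e i),
      a ∈ ppList ∧ a ∣ E := by
    intro a ha
    obtain ⟨i, hi, rfl⟩ := Multiset.mem_map.1 ha
    have hi' : 0 < e i := (Finset.mem_filter.1 hi).2
    exact ⟨pow_mem_ppList (hp i) hi' (le_trans (Nat.le_of_dvd (by omega) (hdvd i)) (by omega)), hdvd i⟩
  obtain ⟨s, hs, hD⟩ :=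
    exists_hostSeed211K4_dom hE1 hE17 (fun a ha => (hmem a ha).1) (fun a ha => (hmem a ha).2) hprod
  obtain ⟨φ, hφ, -⟩ := exists_emb_of_dom (fun i => p i ^ e i) hq0 s _ hD
  exact exists_isSTPP_211_of_injective φ hφ (exists_211pow4_of_mem_hostSeeds211K4 s hs)

/-- **THE LAW: every finite abelian group of order `≥ 18` admits an STPP family of size pattern `(2,1,1)⁴`** (CKSU Def. 5.1, tree `IsSTPP`).
Exponent `≥ 18`: the cyclic ray; exponent `≤ 17`: structure theorem + kernel-decided domination of one of 19 minimal seed types + generic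
embedding.  No `ω` bound follows. [cite: CohnKleinbergSzegedyUmans2005, Def. 5.1] -/
theorem exists_isSTPP_211pow4_of_card_ge_18 {G : Type*} [AddCommGroup G] [Finite G] (hG : 18 ≤ Nat.card G) :
    ∃ A B C : Fin 4 → Finset G, IsSTPP A B C ∧ ∀ i, (A i).card = 2 ∧ (B i).card = 1 ∧ (C i).card = 1 := by
  classical
  by_cases hexp : 18 ≤ AddMonoid.exponent G
  · obtain ⟨g, hg⟩ := AddMonoid.exists_addOrderOf_eq_exponent (AddMonoid.ExponentExists.of_finite (G := G))
    exact exists_isSTPP_211pow4_of_addOrderOf g (by rw [hg]; exact hexp)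
  obtain ⟨ι, _, p, hp, e, ⟨g⟩⟩ := AddCommGroup.equiv_directSum_zmod_of_finite G
  let f : G ≃+ (Π i, ZMod (p i ^ e i)) :=
    g.trans (DirectSum.linearEquivFunOnFintype ℕ ι (fun i => ZMod (p i ^ e i))).toAddEquiv
  have hE1 : 1 ≤ AddMonoid.exponent G := Nat.pos_of_ne_zero AddMonoid.exponent_ne_zero_of_finite
  have hdvd : ∀ i, p i ^ e i ∣ AddMonoid.exponent G := fun i => by
    have hinj : Function.Injective (AddMonoidHom.single (fun j => ZMod (p j ^ e j)) i) :=
      Pi.single_injective (M := fun j => ZMod (p j ^ e j)) i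
    have h1 : addOrderOf (f.symm (AddMonoidHom.single (fun j => ZMod (p j ^ e j)) i 1)) = p i ^ e i := by
      rw [AddEquiv.addOrderOf_eq, addOrderOf_injective _ hinj, ZMod.addOrderOf_one]
    rw [← h1]
    exact AddMonoid.addOrder_dvd_exponent _
  have hcard : 18 ≤ ∏ i, p i ^ e i := by
    have : Nat.card G = ∏ i, p i ^ e i := by
      rw [Nat.card_congr f.toEquiv, Nat.card_pi]
      simp [Nat.card_zmod]
    rw [← this]; exact hG
  have h := exists_isSTPP_211pow4_pi p e hp hE1 (by omega) hdvd hcard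
  exact exists_isSTPP_211_of_injective f.symm.toAddMonoidHom f.symm.injective h

/-- **No group of order `17` hosts `(2,1,1)⁴`**: such a group is cyclic (prime order), hence in additive bijection with `ℤ/17`, which hosts no
`(2,1,1)⁴` (tree `not_exists_isSTPP_211pow4_zmod17`, kernel). [cite: CohnKleinbergSzegedyUmans2005, Def. 5.1] -/
theorem not_exists_isSTPP_211pow4_of_card_eq_17 {G : Type*} [AddCommGroup G] [Finite G] (hG : Nat.card G = 17) :
    ¬ ∃ A B C : Fin 4 → Finset G, IsSTPP A B C ∧ ∀ i, (A i).card = 2 ∧ (B i).card = 1 ∧ (C i).card = 1 := by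
  classical
  haveI : Nontrivial G := Finite.one_lt_card_iff_nontrivial.1 (by rw [hG]; norm_num)
  obtain ⟨g, hg0⟩ := exists_ne (0 : G)
  have hg : addOrderOf g = 17 := by
    have hdvd : addOrderOf g ∣ 17 := hG ▸ addOrderOf_dvd_natCard g
    rcases (Nat.dvd_prime (by norm_num)).1 hdvd with h1 | h17
    · exact absurd (AddMonoid.addOrderOf_eq_one_iff.1 h1) hg0
    · exact h17
  have h17 : ¬ ∃ A B C : Fin 4 → Finset (ZMod (addOrderOf g)), IsSTPP A B C ∧
      ∀ i, (A i).card = 2 ∧ (B i).card = 1 ∧ (C i).card = 1 := by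
    rw [hg]; exact not_exists_isSTPP_211pow4_zmod17
  exact not_exists_isSTPP_211_of_card_eq _ (zmod_lift_zmultiples_injective g) (by rw [Nat.card_zmod, hg, hG]) h17

/-- **THE COLUMN `T1 ≥ 4` IN CLOSED FORM (kernel, ALL finite abelian groups): `G` admits an STPP family of size pattern `(2,1,1)⁴` iff
`|G| ≥ 18`, or `|G| = 16` and `G` is neither cyclic nor elementary abelian.** [cite: CohnKleinbergSzegedyUmans2005, Def. 5.1] -/
theorem stpp211pow4_iff {G : Type*} [AddCommGroup G] [Finite G] :
    (∃ A B C : Fin 4 → Finset G, IsSTPP A B C ∧ ∀ i, (A i).card = 2 ∧ (B i).card = 1 ∧ (C i).card = 1) ↔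
      (18 ≤ Nat.card G ∨ (Nat.card G = 16 ∧ ¬ IsAddCyclic G ∧ ¬ ∀ x : G, 2 • x = 0)) := by
  constructor
  · intro h
    by_cases h18 : 18 ≤ Nat.card G
    · exact Or.inl h18
    · right
      have h17 : Nat.card G ≠ 17 := fun h17 => not_exists_isSTPP_211pow4_of_card_eq_17 h17 h
      have h16 : Nat.card G = 16 := by
        by_contra hne
        exact not_exists_isSTPP_211pow4_of_card_le (by omega) h
      exact ⟨h16, (stpp211pow4_order16_iff h16).1 h⟩
  · rintro (h18 | ⟨h16, hrest⟩)
    · exact exists_isSTPP_211pow4_of_card_ge_18 h18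
    · exact (stpp211pow4_order16_iff h16).2 hrest

/-- Census name: **`T1(G) ≥ 4 ⟺ |G| ≥ 18 ∨ (|G| = 16 ∧ G ∉ {ℤ/16, (ℤ/2)⁴})`** — «above the onset, ORDER — not type — decides» for the
`T1` column at `k = 4`, with the onset row (order 16) as the only type-sensitive order and order 17 empty. [cite: CohnKleinbergSzegedyUmans2005, Def. 5.1] -/
theorem stpp211pow4_orderLaw {G : Type*} [AddCommGroup G] [Finite G] (hG : 18 ≤ Nat.card G) :
    ∃ A B C : Fin 4 → Finset G, IsSTPP A B C ∧ ∀ i, (A i).card = 2 ∧ (B i).card = 1 ∧ (C i).card = 1 :=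
  exists_isSTPP_211pow4_of_card_ge_18 hG

end Summit.MatrixMultiplication.OmegaCensus
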